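import Summits.BirchSwinnertonDyer.BirchSwinnertonDyer.Theorems.PrintCFramBottomClassIndexLawFiveLeOffLocusNoKrizLiDatum11
import Summits.BirchSwinnertonDyer.BirchSwinnertonDyer.Theorems.PrintCFramBottomClassIndexLawFiveLeKrizLiBindersKroneckerOdd
import Summits.BirchSwinnertonDyer.Rank1Residual.X12.O11.RouteUTraceForm
import Summits.BirchSwinnertonDyer.Rank1Residual.X12.O11.RouteUJacobiCertificate
import Literature.NumberTheory.EllipticCurves.PAdicLFunctionQuadraticTwistBirchSharedPrimesProofs
import Literature.NumberTheory.EllipticCurves.ModularityVersionApProofs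
import Literature.NumberTheory.EllipticCurves.BSDSelmerCMPConverseMaximalOrderProofs
import Literature.NumberTheory.EllipticCurves.HeegnerPointReflectionProofs
import Literature.NumberTheory.DiophantineGeometry.LocalReductionProofs
import Literature.NumberTheory.EllipticCurves.LeadingTermBSZOrdinaryProofs
import Mathlib.Tactic.NormNum.LegendreSymbol
import HarnessLib

/-!
# Crux `PrintCFram.BottomClassIndexLawFiveLe` (stmt-BirchSwinnertonDyer-20372), line `eisenstein-resource-bdp-line` (registry v10):
# THE LOCUS BOUNDARY IS A KERNEL STATEMENT, II — class 305809c (`A(7)^{(−79)}`, `p = 7`) has NO Kriz–Li datum over any Heegner field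
# (cell `bsd-print-cfram`, width seat `bsd-line-cfram-p1-w3` g3; THEOREMS ONLY, `--supports` 20372; BSD is not proved by any of this)

HONEST FRAMING. Nothing here is a statement about BSD; no stub of the skeleton is closed. Companion of `…OffLocusNoKrizLiDatum11`
(17424bl at `p = 11`) for the SECOND off-locus window class of the w2 g4 census, `305809c1@7` (the 𝒞₇ member `D = −79`): for every `W`
that is `ℚ`-isogenous to a curve `ℚ`-isomorphic to `A(7)^{(−79)}` (`49a1` twisted by `−79`), the `hKLd` conjunction of the v10 composition
at `p = 7` — a Heegner field `K''` of `N_W`, character data `(f, ψ, ω, ε_K)` with `hss`, and Kriz–Li's hypothesis (4) — is FALSE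
(`not_exists_krizLiDatum_twist_neg79_cm7`). Mechanism as in part I: uniqueness of the Eisenstein pair (w3 g3) transfers (4) to the
explicit odd class character `ψ₀ = χ₋₇₉·ω²` (w3 g2 `KrizLiBinders.krizLiBinders_of_coprime_twist_odd`); the CLASS FACTOR
`B_{1,ψ₀⁻¹} = B_{1,χ₇₉ω⁴}` is a NON-UNIT by the kernel certificate `certSum_553` (`7² ∣ Σ_{j<553} (j/79)·t(j mod 7)·j`, `t(j) ≡ j^{28}
(mod 49)`, Legendre symbols by Euler's criterion; `S = −61936 = −7²·1264`, two numerical engines of w2 g4 agree `v₇ = 1`); the `K''`-FACTOR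
is `7`-integral via the unit `u ≡ 1 (mod 7|d_K|)`, `u ≡ 3 (mod 79)` — here the Heegner hypothesis IS used, once: `79² ∣ N(A(7)^{(−79)})`
(tree `conductorNorm_dvd_and_sq_dvd_conductorNorm_quadraticTwist`) ⟹ `79 ∣ N_W` on the class ⟹ `79` splits in `K''` ⟹ `79 ∤ d_K`
(`not_dvd_discr_of_satisfiesHeegnerHypothesis`), so `u` exists and `(ψ₀ε_Kω⁻¹)(u) = (3/79) = −1 ≠ 1`.
So BOTH census cells of LEAD g6's «no-Kriz–Li-datum locus» are kernel theorems: registry v10's off-locus research stubs (β1,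
pair-sum Kolyvagin) are needed on two explicit ℚ-isogeny classes of the leaf. beyond-print theorem: NO.

References: [KrizLi2019] Thm. 1.20 (pp. 7–8), §7.1 (p. 43); [Washington1997] Thm. 4.2, §5.1; [SilvermanAEC2009] App. C §16;
[GrossLMS1991] §1 (Heegner hypothesis); Cremona tables (class 305809c = `49a` twisted by `−79`).
-/

set_option autoImplicit false
set_option linter.dupNamespace false

noncomputable section

open scoped Classical

namespace Summit.BirchSwinnertonDyer.BirchSwinnertonDyer.Theorems.PrintCFram.OffLocus

open scoped NumberTheorySymbols
open WeierstrassCurve IsDedekindDomain NumberField DirichletCharacter Literature.NumberTheory.LFunctions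
  Literature.NumberTheory.EllipticCurves Literature.NumberTheory.EllipticCurves.ModularForms Literature.NumberTheory.EllipticCurves.Rank1Residual
  Literature.NumberTheory.EllipticCurves.KrizLi2019
  Summit.BirchSwinnertonDyer.Rank1Residual Summit.BirchSwinnertonDyer.Rank1Residual.X12.O11
  Summit.BirchSwinnertonDyer.BirchSwinnertonDyer.Theorems.PrintCFram.BernoulliIntegral
  Summit.BirchSwinnertonDyer.BirchSwinnertonDyer.Theorems.PrintCFram.EisensteinPair

/-! ## §1 The class factor of `A(7)^{(−79)}` (class 305809c): `‖B_{1,χ₇₉·ω⁴}‖₇ ≤ 7⁻¹` -/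

/-- The table `t(j) = j^{7·4} mod 7²`, `0 < j < 7`, checked by the kernel. [folklore] -/
theorem teichmullerPowTable_7_4 : ∀ j, j < 7 → j ≠ 0 →
    j ^ (7 * 4) ≡ (([0, 1, 30, 18, 18, 30, 1] : List ℕ).getD j 0) [MOD 7 ^ 2] := by
  decide +kernel

/-- `ord₇(7·79) = 1`. [folklore] -/
theorem padicValNat_7_mul_79 : padicValNat 7 (7 * 79) = 1 := by
  haveI : Fact (Nat.Prime 7) := ⟨by norm_num⟩
  rw [padicValNat.mul (by norm_num) (by norm_num), padicValNat_self, padicValNat.eq_zero_of_not_dvd (by norm_num)]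

/-- **The certificate sum for `B_{1,χ₇₉ω⁴}`**: `S = Σ_{j mod 553} (j/79)·t(j mod 7)·j = −61936 = −7²·1264` has `7² ∣ S`
(and `7³ ∤ S`: `v₇(B_{1,χ₇₉ω⁴}) = 1`, two numerical engines of w2 g4's census) — checked by the kernel, Legendre symbols by Euler's
criterion (`RouteU.jacobiSym_prime_eq_ite`). [folklore] -/
theorem certSum_553 :
    ((7 : ℕ) : ℤ) ^ 2 ∣ ∑ j : ZMod (7 * 79),
      (J((j.val : ℤ) | 79) * ((([0, 1, 30, 18, 18, 30, 1] : List ℕ).getD (j.val % 7) 0 : ℕ) : ℤ)) * (j.val : ℤ) ^ (0 + 1) := by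
  simp_rw [RouteU.jacobiSym_prime_eq_ite 79 (by norm_num) (by norm_num)]
  decide +kernel

set_option maxRecDepth 40000 in
/-- **THE CLASS FACTOR OF 305809c IS A NON-UNIT: `‖B_{1,χ₇₉·ω⁴}‖₇ ≤ 7⁻¹`.** For every Teichmüller `ω` mod `7` and every `ℚ₇`-valued `χ`
mod `79` with the Legendre values `(a/79)` (the Kronecker character of `ℚ(√−79)`, `−79 ≡ 1 (mod 4)`): the character `χ↑·(ω⁴)↑` mod `553`
— `ψ⁻¹` for the class character `ψ = χ₋₇₉·ω²` of `A(7)^{(−79)}` (w2 g4 census: `305809c1`, `d = −79`) — has a NON-UNIT first Bernoulli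
number. [cite: KrizLi2019, Thm. 1.20 (p. 8, hypothesis (4))] [cite: Washington1997, Thm. 4.2 and §5.1] -/
theorem norm_generalizedBernoulli_classFactor_553_le [Fact (Nat.Prime 7)]
    (ω : DirichletCharacter ℚ_[7] 7) (hω : IsTeichmullerCharacter ω)
    (χ : DirichletCharacter ℚ_[7] 79) (hχ : ∀ a : ℕ, χ (a : ZMod 79) = (J((a : ℤ) | 79) : ℚ_[7])) :
    ‖generalizedBernoulli 1 (changeLevel (dvd_mul_left 79 7) χ * changeLevel (dvd_mul_right 7 79) (ω ^ 4) :
        DirichletCharacter ℚ_[7] (7 * 79))‖ ≤ (7 : ℝ)⁻¹ := by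
  set θ : DirichletCharacter ℚ_[7] (7 * 79) :=
    changeLevel (dvd_mul_left 79 7) χ * changeLevel (dvd_mul_right 7 79) (ω ^ 4) with hθdef
  have hval : ∀ j : ZMod (7 * 79), θ j = χ (j.val : ZMod 79) * ω (j.val : ZMod 7) ^ 4 := by
    intro j
    rw [hθdef, changeLevel_mul_apply_eq (p := 7) χ (ω ^ 4) j, MulChar.pow_apply' _ (by norm_num)]
  -- `θ ≠ 1`: `θ(80) = χ(1)·ω(3)^4 ≡ 3^4 = 81 ≡ 4 ≢ 1 (mod 7)`
  have hθ1 : θ ≠ 1 := by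
    intro h
    have h80 := hval ((80 : ℕ) : ZMod (7 * 79))
    have hv : (((80 : ℕ) : ZMod (7 * 79))).val = 80 := by rw [ZMod.val_natCast]
    have hu : IsUnit (((80 : ℕ) : ZMod (7 * 79))) := (ZMod.isUnit_iff_coprime 80 (7 * 79)).mpr (by norm_num)
    have h1 : ((80 : ℕ) : ZMod 79) = ((1 : ℕ) : ZMod 79) := (ZMod.natCast_eq_natCast_iff' 80 1 79).mpr (by norm_num)
    have h3 : ((80 : ℕ) : ZMod 7) = ((3 : ℕ) : ZMod 7) := (ZMod.natCast_eq_natCast_iff' 80 3 7).mpr (by norm_num)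
    rw [h, MulChar.one_apply hu, hv, h1, h3, hχ 1] at h80
    have hj : (J(((1 : ℕ) : ℤ) | 79) : ℚ_[7]) = 1 := by norm_num
    rw [hj, one_mul] at h80
    have ht := AnchorReduction.norm_teichmuller_pow_sub_table_le ω hω (k := 4) (by norm_num)
      (fun j => ([0, 1, 30, 18, 18, 30, 1] : List ℕ).getD j 0) rfl teichmullerPowTable_7_4 ((3 : ℕ) : ZMod 7)
    have hv3 : (((3 : ℕ) : ZMod 7)).val = 3 := by rw [ZMod.val_natCast]
    rw [hv3] at ht
    simp only [List.getD_cons_succ, List.getD_cons_zero] at ht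
    rw [← h80] at ht
    have hn : ‖(1 : ℚ_[7]) - ((18 : ℕ) : ℚ_[7])‖ = 1 := by
      rw [show (1 : ℚ_[7]) - ((18 : ℕ) : ℚ_[7]) = ((-17 : ℤ) : ℚ_[7]) by push_cast; ring]
      exact Padic.norm_intCast_eq_one_iff.mpr (by norm_num)
    rw [hn] at ht
    norm_num at ht
  refine norm_generalizedBernoulli_one_le_inv_of_cert θ hθ1 padicValNat_7_mul_79
    (fun j => J((j.val : ℤ) | 79) * ((([0, 1, 30, 18, 18, 30, 1] : List ℕ).getD (j.val % 7) 0 : ℕ) : ℤ)) 0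
    (fun j => ?_) certSum_553
  rw [pow_zero, mul_one, hval j, hχ j.val]
  have hv : (j.val : ZMod 7).val = j.val % 7 := ZMod.val_natCast _ _
  have htab := AnchorReduction.norm_teichmuller_pow_sub_table_le ω hω (k := 4) (by norm_num)
    (fun j => ([0, 1, 30, 18, 18, 30, 1] : List ℕ).getD j 0) rfl teichmullerPowTable_7_4 (j.val : ZMod 7)
  rw [hv] at htab
  have hL : ‖(J((j.val : ℤ) | 79) : ℚ_[7])‖ ≤ 1 := Padic.norm_int_le_one _
  have hsplit : (J((j.val : ℤ) | 79) : ℚ_[7]) * ω (j.val : ZMod 7) ^ 4 -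
      ((J((j.val : ℤ) | 79) * ((([0, 1, 30, 18, 18, 30, 1] : List ℕ).getD (j.val % 7) 0 : ℕ) : ℤ) : ℤ) : ℚ_[7]) =
      (J((j.val : ℤ) | 79) : ℚ_[7]) * (ω (j.val : ZMod 7) ^ 4 - ((([0, 1, 30, 18, 18, 30, 1] : List ℕ).getD (j.val % 7) 0 : ℕ) : ℚ_[7])) := by
    push_cast; ring
  rw [hsplit, norm_mul]
  calc ‖(J((j.val : ℤ) | 79) : ℚ_[7])‖ * _ ≤ 1 * (7 : ℝ) ^ (-2 : ℤ) := mul_le_mul hL htab (norm_nonneg _) zero_le_one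
    _ = ((7 : ℕ) : ℝ) ^ (-2 : ℤ) := by rw [one_mul]; norm_num

/-! ## §2 `79 ∣ N_W` on the class, hence `79 ∤ d_K` for every Heegner field -/

/-- **`A(7)^{(−79)}` is BAD at `79`** (`79² ∣ N`, Atkin–Lehner–Li / tree `conductorNorm_dvd_and_sq_dvd_conductorNorm_quadraticTwist`),
and so is every curve `ℚ`-isogenous to a `ℚ`-isomorphic curve. [cite: SilvermanAEC2009, App. C §16] -/
theorem not_hasGoodReductionAtPrime_79_of_twist (W W₁ : WeierstrassCurve ℚ) [W.IsElliptic] [W₁.IsElliptic]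
    (hiso : IsIsogenous W W₁) (hW₁ : ∃ C : VariableChange ℚ, C • W₁ = cm7.quadraticTwist ((-79 : ℤ) : ℚ)) :
    ¬ (haveI : Fact (Nat.Prime 79) := ⟨by norm_num⟩; W.HasGoodReductionAtPrime 79) := by
  haveI : Fact (Nat.Prime 79) := ⟨by norm_num⟩
  haveI : Fact (Nat.Prime 7) := ⟨by norm_num⟩
  haveI : cm7.IsGloballyMinimal := RouteU.isGloballyMinimal_X049_eq
  have hdq : (((-79 : ℤ)) : ℚ) ≠ 0 := by norm_num
  haveI := cm7.isElliptic_quadraticTwist hdq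
  obtain ⟨C, hC⟩ := hW₁
  -- `79² ∣ N(A(7)^{(−79)})`
  have hsqf : Squarefree (-79 : ℤ) := by
    rw [← Int.squarefree_natAbs]; exact (Nat.Prime.prime (by norm_num)).squarefree
  have hsq := (cm7.conductorNorm_dvd_and_sq_dvd_conductorNorm_quadraticTwist (d := -79) (by norm_num) hsqf
    (fun w hw => Or.inl ?_)).2.1
  swap
  · -- `cm7` is good at the primes of `79`
    have h79 : ((Rat.HeightOneSpectrum.primesEquiv w : ℕ) : ℤ) ∣ 79 := by simpa using hw
    have hwp : (Rat.HeightOneSpectrum.primesEquiv w : ℕ).Prime := (Rat.HeightOneSpectrum.primesEquiv w).2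
    have hw79 : (Rat.HeightOneSpectrum.primesEquiv w : ℕ) = 79 :=
      (Nat.prime_dvd_prime_iff_eq hwp (by norm_num)).mp (by exact_mod_cast h79)
    haveI := Fact.mk hwp
    have hg : cm7.HasGoodReductionAtPrime (Rat.HeightOneSpectrum.primesEquiv w : ℕ) :=
      RouteU.hasGoodReductionAtPrime_cm7 _ (by rw [hw79]; norm_num)
    exact (hasGoodReductionAtPrime_iff_hasGoodReductionAt_ringOfIntegers w cm7).mp hg
  have h79N : 79 ∣ (cm7.quadraticTwist (((-79 : ℤ)) : ℚ)).conductorNorm ℤ :=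
    dvd_trans (Dvd.intro 79 (by norm_num)) hsq
  have hbad : ¬ (cm7.quadraticTwist (((-79 : ℤ)) : ℚ)).HasGoodReductionAtPrime 79 :=
    ((cm7.quadraticTwist (((-79 : ℤ)) : ℚ)).dvd_conductorNorm_iff_not_hasGoodReductionAtPrime 79).mp h79N
  intro hW
  have h1 : (C • W₁).HasGoodReductionAtPrime 79 :=
    (BSZLemma17.hasGoodReductionAtPrime_smul_iff W₁ C 79).mpr ((hiso.hasGoodReductionAtPrime_iff 79).mp hW)
  rw [hC] at h1
  exact hbad h1

/-- **A unit `u` of `ℤ/(553·d·7)` with `u ≡ 1 (mod 7·d)` and `u ≡ 3 (mod 79)`** (`79 ∤ d`, `7·d` coprime to `79`). [folklore] -/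
theorem exists_unit_one_three (d : ℕ) [NeZero d] (hd : ¬ 79 ∣ d) :
    ∃ n₀ : ℕ, n₀.Coprime (7 * 79 * d * 7) ∧ (n₀ : ZMod 79) = ((3 : ℕ) : ZMod 79) ∧ (n₀ : ZMod 7) = 1 ∧
      (n₀ : ZMod d) = 1 := by
  have hcop : Nat.Coprime 79 (7 * d) := by
    refine Nat.Coprime.mul_right (by norm_num) ((Nat.Prime.coprime_iff_not_dvd (by norm_num)).mpr hd)
  obtain ⟨n₀, h3, h1⟩ := Nat.chineseRemainder hcop 3 1
  have h7 : n₀ ≡ 1 [MOD 7] := h1.of_mul_right d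
  have hdd : n₀ ≡ 1 [MOD d] := h1.of_mul_left 7
  refine ⟨n₀, ?_, (ZMod.natCast_eq_natCast_iff' n₀ 3 79).mpr h3, ?_, ?_⟩
  · have c79 : n₀.Coprime 79 := by
      have : Nat.gcd n₀ 79 = Nat.gcd 3 79 := Nat.ModEq.gcd_eq h3
      rw [Nat.Coprime, this]; decide
    have c7 : n₀.Coprime 7 := by
      have : Nat.gcd n₀ 7 = Nat.gcd 1 7 := Nat.ModEq.gcd_eq h7
      rw [Nat.Coprime, this, Nat.gcd_one_left]
    have cd : n₀.Coprime d := by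
      have : Nat.gcd n₀ d = Nat.gcd 1 d := Nat.ModEq.gcd_eq hdd
      rw [Nat.Coprime, this, Nat.gcd_one_left]
    exact Nat.Coprime.mul_right (Nat.Coprime.mul_right (Nat.Coprime.mul_right c7 c79) cd) c7
  · rw [(ZMod.natCast_eq_natCast_iff' n₀ 1 7).mpr h7, Nat.cast_one]
  · rw [(ZMod.natCast_eq_natCast_iff' n₀ 1 d).mpr hdd, Nat.cast_one]

/-! ## §3 305809c has NO Kriz–Li datum over any Heegner field -/

set_option maxRecDepth 40000 in
/-- **305809c HAS NO KRIZ–LI DATUM (the locus boundary of v10 at `p = 7`).** Let `W/ℚ` be any elliptic curve `ℚ`-isogenous to a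
curve `ℚ`-isomorphic to `A(7)^{(−79)}` (Cremona class `305809c`, the census cell `305809c1@7`). Then there are NO data
`(K'', f, ψ, ω, ε_K, …)` as in the `hKLd` branch of the line's composition at `p = 7`: the trace form forces the Bernoulli pair of any
admissible `ψ` to be that of the class character `χ₋₇₉ω²` (uniqueness of the Eisenstein pair), whose class factor `B_{1,χ₇₉ω⁴}` is a
NON-UNIT (`certSum_553`) and whose `K''`-factor is `7`-integral (unit `u ≡ 1 (7|d_K|)`, `u ≡ 3 (79)`, value `(3/79) = −1`; this uses
`79 ∤ d_K`, i.e. the Heegner hypothesis at the bad prime `79 ∣ N_W`). So (4) FAILS: on this ℚ-isogeny class too the v10 composition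
is in its OFF-LOCUS branch. [cite: KrizLi2019, Thm. 1.20 (pp. 7–8), §7.1 (p. 43)] [cite: Washington1997, §5.1, Thm. 4.2] -/
theorem not_exists_krizLiDatum_twist_neg79_cm7 [Fact (Nat.Prime 7)] (W W₁ : WeierstrassCurve ℚ) [W.IsElliptic]
    [W₁.IsElliptic] (hiso : IsIsogenous W W₁) (hW₁ : ∃ C : VariableChange ℚ, C • W₁ = cm7.quadraticTwist ((-79 : ℤ) : ℚ)) :
    ¬ ∃ (N : ℕ) (_ : NeZero N) (K : Type) (_ : Field K) (_ : NumberField K) (Dt : ModularParametrizationData W N)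
          (H : HeegnerDatum N (NumberField.discr K)) (ι : K →+* ℂ) (P : (W.baseChange K).toAffine.Point)
          (f : ℕ) (_ : NeZero f) (ψ : DirichletCharacter ℚ_[7] f) (ω : DirichletCharacter ℚ_[7] 7)
          (εK : DirichletCharacter ℚ_[7] (NumberField.discr K).natAbs),
          W.conductorNorm ℤ = N ∧ IsImaginaryQuadratic K ∧ SatisfiesHeegnerHypothesis N K ∧ Odd (NumberField.discr K) ∧
          NumberField.discr K < -4 ∧ (W.quadraticTwist (NumberField.discr K : ℚ)).entireLFunction 1 ≠ 0 ∧
          WeierstrassCurve.Affine.Point.map ι.toRatAlgHom P = heegnerPointComplex Dt H ∧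
          ψ.IsPrimitive ∧ IsTeichmullerCharacter ω ∧
          (∀ ℓ : ℕ, ℓ.Prime → ¬ (ℓ ∣ 7 * W.conductorNorm ℤ) →
            ‖((W.LFunction ℓ : ℤ) : ℚ_[7]) - (ψ (ℓ : ZMod f) + ψ⁻¹ (ℓ : ZMod f) * ω (ℓ : ZMod 7))‖ < 1) ∧
          ψ (7 : ZMod f) ≠ 1 ∧ primVal (invMulOmega ψ ω) 7 ≠ 1 ∧
          (∀ ℓ : ℕ, (hℓ : ℓ.Prime) → ℓ ≠ 7 →
            (haveI := Fact.mk hℓ; ¬ W.HasGoodReductionAtPrime ℓ ∧ ¬ W.HasMultiplicativeReductionAtPrime ℓ) →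
            ψ (ℓ : ZMod f) ≠ 1 ∧ primVal (invMulOmega ψ ω) ℓ ≠ 1) ∧
          IsKroneckerCharacterOf K εK ∧
          ¬ (‖bernoulliOnePrim (bernoulliCharOne ψ εK) *
              bernoulliOnePrim (bernoulliCharTwo ψ εK ω)‖ ≤ (7 : ℝ)⁻¹) := by
  rintro ⟨N, _, K, _, _, _Dt, _H, _ι, _P, f, hf, ψ, ω, εK, hN, hK, hHN, _hodd, _hd4, _hLt, -, _hψ, hω, hss, -, -, -, _hεK,
    h4⟩
  apply h4
  have h72 : (7 : ℕ) ≠ 2 := by norm_num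
  have hd0 : (NumberField.discr K).natAbs ≠ 0 := Int.natAbs_ne_zero.mpr (NumberField.discr_ne_zero K)
  haveI : NeZero (NumberField.discr K).natAbs := ⟨hd0⟩
  -- `79 ∣ N_W`, hence `79 ∤ d_K` (Heegner hypothesis)
  have h79N : 79 ∣ N := by
    rw [← hN]
    haveI : Fact (Nat.Prime 79) := ⟨by norm_num⟩
    exact (W.dvd_conductorNorm_iff_not_hasGoodReductionAtPrime 79).mpr (not_hasGoodReductionAtPrime_79_of_twist W W₁ hiso hW₁)
  have h79d : ¬ 79 ∣ (NumberField.discr K).natAbs := by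
    intro h
    exact not_dvd_discr_of_satisfiesHeegnerHypothesis hK hHN (by norm_num : Nat.Prime 79) h79N (Int.dvd_natAbs.mp (by exact_mod_cast h))
  -- the class character `ψ₀ = χ₇₉↑·(ω²)↑` at level `7·79`
  haveI : NeZero ((-79 : ℤ)).natAbs := ⟨by decide⟩
  obtain ⟨χ, hχ⟩ := KrizLiBinders.exists_jacobiCharPadic (p := 7) ((-79 : ℤ)).natAbs
  obtain ⟨_, hss₀, -, -⟩ := KrizLiBinders.krizLiBinders_of_coprime_twist_odd (p := 7) h72 cm7 (k := 2) (by norm_num)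
    (by norm_num) (fun q _ hq => RouteU.hasGoodReductionAtPrime_cm7 q hq)
    (fun ℓ _ hℓ => by simpa using RouteU.lFunction_cm7_mod_seven ℓ hℓ) W W₁ hiso (e := -79) (by norm_num)
    (by rw [← Int.squarefree_natAbs]; exact (Nat.Prime.prime (by norm_num)).squarefree) (by norm_num) hW₁ χ hχ ω hω
  set ψ₀ : DirichletCharacter ℚ_[7] (7 * ((-79 : ℤ)).natAbs) :=
    changeLevel (dvd_mul_left ((-79 : ℤ)).natAbs 7) χ * changeLevel (dvd_mul_right 7 ((-79 : ℤ)).natAbs) (ω ^ 2) with hψ₀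
  refine krizLi_hypothesis_four_fails_of_hss (by norm_num) W ψ₀ ψ ω hω εK hss₀ hss ?_
  -- `ψ₀` odd: `χ(−1) = (78/79) = −1`, `k = 2` even
  have hχneg : χ (-1) = -1 := by
    have e : ((78 : ℕ) : ZMod ((-79 : ℤ)).natAbs) = -1 := by decide
    rw [← e, hχ 78]; norm_num
  have hψ₀odd : ψ₀.Odd := by
    rw [hψ₀]
    exact KrizLiBinders.psi_odd_of ω χ 2 h72 hω (by norm_num) (by rw [hχneg]; norm_num)
  have hψ₀ne : ¬ ψ₀.Even := not_even_of_odd' ψ₀ hψ₀odd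
  -- the class factor
  have hcls : ‖bernoulliOnePrim ψ₀⁻¹‖ ≤ (7 : ℝ)⁻¹ := by
    have hχq : χ⁻¹ = χ := MulChar.IsQuadratic.inv (KrizLiBinders.isQuadratic_of_forall_eq_jacobiSym hχ)
    have hinv : ψ₀⁻¹ = changeLevel (dvd_mul_left ((-79 : ℤ)).natAbs 7) χ *
        changeLevel (dvd_mul_right 7 ((-79 : ℤ)).natAbs) (ω ^ 4) := by
      rw [hψ₀, mul_inv, ← map_inv, ← map_inv, hχq, KrizLiBinders.char_pow_inv_eq ω (by norm_num)]
    have hprim : (changeLevel (dvd_mul_left ((-79 : ℤ)).natAbs 7) χ *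
        changeLevel (dvd_mul_right 7 ((-79 : ℤ)).natAbs) (ω ^ 4) : DirichletCharacter ℚ_[7] (7 * ((-79 : ℤ)).natAbs)).IsPrimitive :=
      KrizLiBinders.psi_isPrimitive ω χ 4 (by norm_num)
        (KrizLiBinders.isPrimitive_of_forall_eq_jacobiSym hχ (by decide) ((Nat.Prime.prime (by norm_num : Nat.Prime 79)).squarefree))
        (KrizLiBinders.teichmuller_pow_ne_one hω (by norm_num) (by norm_num))
    rw [hinv, RouteU.bernoulliOnePrim_eq_of_isPrimitive _ hprim]
    exact norm_generalizedBernoulli_classFactor_553_le ω hω χ hχ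
  -- the unit
  obtain ⟨n₀, hcop, h79', h7', hdK⟩ := exists_unit_one_three (NumberField.discr K).natAbs h79d
  have hcop' : n₀.Coprime (7 * ((-79 : ℤ)).natAbs * (NumberField.discr K).natAbs * 7) := hcop
  set u : (ZMod (7 * ((-79 : ℤ)).natAbs * (NumberField.discr K).natAbs * 7))ˣ := ZMod.unitOfCoprime n₀ hcop' with hu
  have huval : (u : ZMod (7 * ((-79 : ℤ)).natAbs * (NumberField.discr K).natAbs * 7)) = n₀ :=
    ZMod.coe_unitOfCoprime n₀ hcop'
  refine krizLi_bernoulli_hypothesis_fails_of_classFactor_of_unit h72 ψ₀ εK ω hψ₀ne hcls u ?_ ?_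
  · rw [huval, ZMod.val_natCast]
    have hmod : n₀ % (7 * ((-79 : ℤ)).natAbs * (NumberField.discr K).natAbs * 7) ≡ n₀ [MOD 7] :=
      (Nat.mod_modEq n₀ _).of_dvd (Dvd.intro_left _ rfl)
    rw [(ZMod.natCast_eq_natCast_iff' _ _ 7).mpr hmod, h7']
  · have hcopZ : IsCoprime (n₀ : ℤ) ((7 * ((-79 : ℤ)).natAbs * (NumberField.discr K).natAbs * 7 : ℕ) : ℤ) :=
      Nat.isCoprime_iff_coprime.mpr hcop'
    have hcopZ' : IsCoprime (n₀ : ℤ) ((7 * ((-79 : ℤ)).natAbs * (NumberField.discr K).natAbs : ℕ) : ℤ) :=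
      Nat.isCoprime_iff_coprime.mpr (Nat.Coprime.coprime_dvd_right (Dvd.intro 7 rfl) hcop')
    have hcopZ'' : IsCoprime (n₀ : ℤ) ((7 * ((-79 : ℤ)).natAbs : ℕ) : ℤ) :=
      Nat.isCoprime_iff_coprime.mpr (Nat.Coprime.coprime_dvd_right (Dvd.intro ((NumberField.discr K).natAbs * 7) (by ring)) hcop')
    have en : (u : ZMod (7 * ((-79 : ℤ)).natAbs * (NumberField.discr K).natAbs * 7)) = ((n₀ : ℤ) : ZMod _) := by
      rw [huval, Int.cast_natCast]
    rw [en, RegularLocusBernoulliPair.bernoulliCharTwo_of_not_even ψ₀ εK ω hψ₀ne, MulChar.mul_apply,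
      changeLevel_eq_cast_of_dvd' _ _ hcopZ, changeLevel_eq_cast_of_dvd' _ _ hcopZ, MulChar.mul_apply,
      changeLevel_eq_cast_of_dvd' _ _ hcopZ', changeLevel_eq_cast_of_dvd' _ _ hcopZ', hψ₀, MulChar.mul_apply,
      changeLevel_eq_cast_of_dvd' _ _ hcopZ'', changeLevel_eq_cast_of_dvd' _ _ hcopZ'']
    have h79'' : ((n₀ : ℕ) : ZMod ((-79 : ℤ)).natAbs) = ((3 : ℕ) : ZMod ((-79 : ℤ)).natAbs) := h79'
    have hχn : χ (((n₀ : ℕ) : ℤ) : ZMod ((-79 : ℤ)).natAbs) = -1 := by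
      rw [Int.cast_natCast, h79'', hχ 3]
      have : J(((3 : ℕ) : ℤ) | ((-79 : ℤ)).natAbs) = -1 := by norm_num
      rw [this]; norm_num
    have hωn : (ω ^ 2) (((n₀ : ℕ) : ℤ) : ZMod 7) = 1 := by rw [Int.cast_natCast, h7', map_one]
    have hωn' : ω⁻¹ (((n₀ : ℕ) : ℤ) : ZMod 7) = 1 := by rw [Int.cast_natCast, h7', map_one]
    have hεn : εK (((n₀ : ℕ) : ℤ) : ZMod (NumberField.discr K).natAbs) = 1 := by rw [Int.cast_natCast, hdK, map_one]
    rw [hχn, hωn, hωn', hεn]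
    norm_num

end Summit.BirchSwinnertonDyer.BirchSwinnertonDyer.Theorems.PrintCFram.OffLocus

end
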